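import Summits.AtomisticToContinuum.HydrodynamicLimit.Theorems.RelayRaceLocalityNearConstantShortTimeHLAssemblyTheta
import Summits.AtomisticToContinuum.HydrodynamicLimit.Theorems.RelayRaceLocalityNearConstantShortTimeHLGeneralFamilyLDA
import HarnessLib

/-!
# Crux `NearConstantShortTimeHL` (stmt-AtomisticToContinuum-12502), line `small-tilt-domination` — stub `statics_time_zero`

Support file for the crux `…Theses.RelayRaceLocality.NearConstantShortTimeHL` (route
`route-AtomisticToContinuum-RelayRaceLocality`), line `small-tilt-domination`, stub `statics_time_zero` of the
relative-entropy Grönwall assembly (`stub_gronwallAssembly`, lead c4).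

At time `0` the true law and the Euler-matched local Gibbs law coincide, so the two static inputs of Yau's method at
`r = 0` — the pressure-per-particle limit `π_N(0) → π(0) = ∫ ρ₀ · ρ₀σ³ f_ex′(ρ₀σ³)` and the convergence of the mean
of the log-profile observable `E[X_0] → m^{st}(0) = ∫ ρ₀ (log ρ₀ + g_σ(ρ₀) − 3/2 log(2πθ₀) − 3/2)` — are exactly the
LANDED local density approximation for general `(ε_N, n_N)` families, `stub_ldaGeneralFamilies : GeneralFamilyLDA`
(`…GeneralFamilyLDA.lean`), instantiated at the time-zero data `(ρ 0, u 0, θ 0)` with the lower density bound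
`c := min ρ 0` (a minimiser of the continuous `ρ 0` on the compact torus). This file only re-expresses that
statement in the assembly's vocabulary:

* the `let g` of `GeneralFamilyLDA` is `gChem σ` (definitionally), so its activity `a₁ = ρ₁ e^{g(ρ₁)}` is the
  assembly's `fun x => ρ 0 x * Real.exp (gChem σ (ρ 0 x))`;
* its law `Q_N = (liouville 𝕋³ n_N ε_N).withDensity (ofReal ∘ canonicalDensity …)` is `particleLaw (Φ N)
  (canonicalDensity …)` (definitionally, `particleLaw_eq`; the flow `Φ N` only fixes the type);
* its integrand `∫ Λ₁ dμ_z` is the log-profile observable `logProfileObs σ ρ θ u 0 z` (`logProfileObs_eq_integral`).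

`statics_time_zero` — the statement, with threshold `ηL := η₁` of `GeneralFamilyLDA`.
References: H.-T. Yau, Lett. Math. Phys. 22 (1991) §2; E. Pulvirenti – D. Tsagkarogiannis, Comm. Math. Phys. 316
(2012) Thm 2.1.
-/

noncomputable section

namespace Summit.AtomisticToContinuum.HydrodynamicLimit.Theorems.NearConstantShortTimeHL

open scoped BigOperators ENNReal Topology
open MeasureTheory Set Filter
open Literature.MathematicalPhysics.KineticTheory Literature.Analysis.FluidPDE Literature.Analysis.FunctionSpaces

/-- **Statics at time zero** (Yau's relative-entropy method, the two static inputs at `r = 0`). There is a packing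
threshold `ηL > 0` such that for every `σ > 0`, all continuous time-zero profiles `ρ 0 > 0`, `θ 0 > 0`, `u 0` with
`ρ 0 · σ³ ≤ ηL` and unit mass, every admissible family (`ε_N > 0`, `ε_N → 0`, `n_N ε_N³ → σ³`) and every family of
hard-sphere flows `Φ N` (fixing the types only), for the canonical local Gibbs laws
`P_N = particleLaw (Φ N) (canonicalDensity 𝕋³ ε_N n_N (localGibbsProfile (ρ₀ e^{g_σ(ρ₀)}) u₀ θ₀))`:
(i) `n_N⁻¹ log Z_N → ∫ ρ₀ · ρ₀σ³ f_ex′(ρ₀σ³)`; (ii) the log-profile observable `X_0 = logProfileObs σ ρ θ u 0` is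
eventually `P_N`-integrable; (iii) `E_{P_N}[X_0] → ∫ ρ₀ (log ρ₀ + g_σ(ρ₀) − 3/2 log(2πθ₀) − 3/2)`.
This is `stub_ldaGeneralFamilies` at `c := min ρ 0`, rewritten through `logProfileObs_eq_integral`.
[cite: Yau1991, §2] [cite: PulvirentiTsagkarogiannis2012, Thm 2.1] -/
theorem statics_time_zero : ∃ ηL : ℝ, 0 < ηL ∧ ∀ {σ : ℝ}, 0 < σ → ∀ {ρ θ : ℝ → T3 → ℝ} {u : ℝ → T3 → V3}, Continuous (ρ 0) → Continuous (θ 0) → Continuous (u 0) → (∀ x, 0 < ρ 0 x) → (∀ x, 0 < θ 0 x) → (∀ x, ρ 0 x * σ ^ 3 ≤ ηL) → (∫ x, ρ 0 x) = 1 → ∀ {ε : ℕ → ℝ} {n : ℕ → ℕ}, (∀ N, 0 < ε N) → Tendsto ε atTop (nhds 0) → Tendsto (fun N => (n N : ℝ) * ε N ^ 3) atTop (nhds (σ ^ 3)) → ∀ (Φ : (N : ℕ) → HardSphereFlow (Torus.geometry (Fin 3)) (ε N) (n N)), Tendsto (fun N => (n N : ℝ)⁻¹ * Real.log (canonicalPartition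 (Torus.geometry (Fin 3)) (ε N) (n N) (localGibbsProfile (fun x => ρ 0 x * Real.exp (gChem σ (ρ 0 x))) (u 0) (θ 0)))) atTop (nhds (∫ x, ρ 0 x * (ρ 0 x * σ ^ 3 * deriv hsExcessFreeEnergy (ρ 0 x * σ ^ 3)))) ∧ (∀ᶠ N in atTop, Integrable (fun z => logProfileObs σ ρ θ u 0 z) (particleLaw (Φ N) (canonicalDensity (Torus.geometry (Fin 3)) (ε N) (n N) (localGibbsProfile (fun x => ρ 0 x * Real.exp (gChem σ (ρ 0 x))) (u 0) (θ 0))))) ∧ Tendsto (fun N => ∫ z, logProfileObs σ ρ θ u 0 z ∂(particleLaw (Φ N) (canonicalDensity (Torus.geometry (Fin 3)) (ε N) (n N) (localGibbsProfile (fun x => ρ 0 x * Real.exp (gChem σ (ρ 0 x))) (u 0) (θ 0))))) atTop (nhds (∫ x, ρ 0 x * (Real.log (ρ 0 x) + gChem σ (ρ 0 x) - 3 / 2 * Real.log (2 * Real.pi * θ 0 x) - 3 / 2))) := by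
  obtain ⟨η₁, hη₁, H⟩ := stub_ldaGeneralFamilies
  refine ⟨η₁, hη₁, ?_⟩
  intro σ hσ ρ θ u hρc hθc huc hρ0 hθ0 hband hmass ε n hε hε0 hn Φ
  -- lower density bound: a minimiser of the continuous `ρ 0` on the compact torus
  obtain ⟨x₀, -, hx₀⟩ := isCompact_univ.exists_isMinOn univ_nonempty hρc.continuousOn
  -- the local density approximation at the time-zero data
  obtain ⟨h1, h2, h3⟩ := H σ hσ (ρ 0 x₀) (hρ0 x₀) (ρ 0) hρc (fun x => ⟨hx₀ (mem_univ x), hband x⟩) hmass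
    (u 0) (θ 0) huc hθc hθ0 ε n hε hε0 hn
  -- the log-profile observable is the empirical mean of the log-profile
  simp_rw [logProfileObs_eq_integral]
  exact ⟨h1, h2, h3⟩

end Summit.AtomisticToContinuum.HydrodynamicLimit.Theorems.NearConstantShortTimeHL

end
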